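import Summits.QuantumFields.YangMills.Theorems.ForcedResponseSkewnessResponseLocalisationStubCollarOfKernel
import Summits.QuantumFields.YangMills.Theorems.ForcedResponseSkewnessResponseLocalisationSmearedDefs
import Summits.QuantumFields.YangMills.Theorems.BalabanLadderNTCanonicalEnvelopes
import HarnessLib

/-!
# Crux `ResponseLocalisation` (rev 5, stmt-QuantumFields-24869), line «smeared-femto»: registered stub `stub_collarOfSmeared`

`Summit.QuantumFields.YangMills.Cruxes.ResponseLocalisation.Smeared.stub_collarOfSmeared : CollarOfSmearedSigR` — the crux-level
ANALYSIS stub of the lead's line «smeared-femto» (width prover `ym-line-frs-p2` g6, STUB BRIEF of 2026-08-28T06:47Z): the torus-level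
smeared collar kernel `SmearedKernelSigR` (per FAR sharp site `y` and near centre `z₁`, the near partner smeared against a Schwartz
weight) implies the rev-4/5 crux body (the δ-collar bound with `0 < p 0`).

Proof (geometry/bookkeeping only — `stub_collarOfKernel` (p600411) with the triangle inequality over the FAR index only): if no pinning
witness exists the admissible family is empty; otherwise the kernel is instantiated at `r₁ = p₀/Λ`, `κ = η/8`, giving `R`; take
`ρ = min (p₀/2) (R/8) ⊓ 1` and, per source, `δ = R/4` and the kernel's thresholds for the weights `v`, `θv` on the window `max Λ (‖p‖+1)`.
For a collar site `x` (`infDist(s x, K) < δ`) either `x` is within unit-`a` torus distance `R` of a lattice support point `z₁` of `v(s·)` and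
`|Σ_{y,z} θv v κ₃| ≤ Σ_y |θv(s y)| · |Σ_z v(s z) κ₃(x,y,z)|`, or of a lattice support point `y₁` of `θv(s·)` and
`|Σ_{y,z} θv v κ₃| ≤ Σ_z |v(s z)| · |Σ_y θv(s y) κ₃(x,z,y)|` (`torusK3_swap`); charged far sites are at unit-`a` torus separation `≥ p₀/Λ`
from the centre (`pair_coords`/`pair_torusDist`); the kernel statement for the weights `v` and `θv` and the Riemann sums
`s⁴Σ|v(s·)|, s⁴Σ|θv(s·)| ≤ 2` give `≤ 2·(2/s⁴)·κ·(aβ)⁴ ≤ 4κ = η/2 ≤ η(1+|∂_cQ2|)`.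

Honest label: ONE analysis stub of a CONDITIONAL rung line (leaf R2a `BalabanLadder.NT`); kernel statement, femto antecedents, crux, NT and
the Yang–Mills mass gap are NOT proved by any of this. -/

set_option autoImplicit false

noncomputable section

open MeasureTheory Filter Topology Metric
open scoped SchwartzMap
open Literature.MathematicalPhysics.QuantumFieldTheory
open Literature.MathematicalPhysics.QuantumLattice hiding torusDist
open Literature.Probability.LatticeModels
open Summit.QuantumFields.YangMills.Cruxes.OSLegsFromFemtoAndGap.DlrCollarTransfer
open Summit.QuantumFields.YangMills.Cruxes.RunningCouplingCeiling.Pointwise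
open Summit.QuantumFields.YangMills.Cruxes.ResponseLocalisation.Birth
open Summit.QuantumFields.YangMills.Cruxes.ResponseLocalisation.Far
open Summit.QuantumFields.YangMills.Cruxes.ResponseLocalisation.Collar


namespace Summit.QuantumFields.YangMills.Cruxes.ResponseLocalisation.Smeared

/-- `siteToE` is additive: `siteToE (z − z₁) = siteToE z − siteToE z₁`. [folklore] -/
theorem siteToE_sub (z z₁ : Fin 4 → ℤ) : siteToE (z - z₁) = siteToE z - siteToE z₁ := by
  ext i
  simp [siteToE_apply]

set_option maxHeartbeats 800000 in
/-- **Registered stub `stub_collarOfSmeared` of line «smeared-femto»**: the torus-level smeared collar kernel implies the rev-5 crux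
`ResponseLocalisation` (contact half, `0 < p 0`).  See the module docstring; `SmearedKernelSigR` is the hypothesis. [folklore] -/
theorem stub_collarOfSmeared : CollarOfSmearedSigR := by
  intro hK G _ _ _ _ hG
  letI : MeasurableSpace G := borel G
  haveI : BorelSpace G := ⟨rfl⟩
  intro r a hpos hlim p hp0 ε hε η hη Λ hΛ
  classical
  have hΛ0 : 0 < Λ := by linarith
  have hp0n : p 0 ≤ ‖p‖ := by
    have h := PiLp.norm_apply_le p (0 : Fin 4)
    rw [Real.norm_eq_abs] at h
    exact (le_abs_self _).trans h
  -- (1) the pinning witness: if there is none, the admissible family is empty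
  by_cases hW : ∃ (v₀ : 𝓢(EuclideanSpace ℝ (Fin 4), ℝ)) (ε' β₅ Λ₅ : ℝ), HasCompactSupport v₀ ∧
      tsupport v₀ ⊆ {y : EuclideanSpace ℝ (Fin 4) | 0 < y 0} ∧ 0 < ε' ∧
      ∀ β : ℝ, β₅ ≤ β → ∀ L : ℕ, Λ₅ ≤ a β * L → ε' ≤ Q2 G r β L (a β) (thetaTest 4 v₀) v₀
  swap
  · refine ⟨p 0 / 2, by positivity, fun v hball hsupp _ hfloor => ?_⟩
    exfalso
    obtain ⟨β₅, Λ₅, hfl⟩ := hfloor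
    exact hW ⟨v, ε, β₅, Λ₅, (isCompact_closedBall p (p 0 / 2)).of_isClosed_subset (isClosed_tsupport _) hball,
      hsupp, hε, hfl⟩
  -- (2) the kernel at separation `p₀/Λ` and `κ = η/8`
  have hr₁ : 0 < p 0 / Λ := by positivity
  have hκ : 0 < η / 8 := by positivity
  obtain ⟨R, hR, hker⟩ := hK G hG r a hpos hlim hW (p 0 / Λ) hr₁ (η / 8) hκ
  set ρ : ℝ := min (min (p 0 / 2) (R / 8)) 1 with hρ
  have hρ0 : 0 < ρ := lt_min (lt_min (by positivity) (by positivity)) one_pos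
  have hρp : ρ ≤ p 0 / 2 := (min_le_left _ _).trans (min_le_left _ _)
  have hρR : ρ ≤ R / 8 := (min_le_left _ _).trans (min_le_right _ _)
  have hρ1 : ρ ≤ 1 := min_le_right _ _
  refine ⟨ρ, hρ0, fun v hball hsupp hL1 _ => ?_⟩
  -- per source: window, kernel thresholds for the weights `v` and `θv`, Riemann thresholds, `δ = R/4`
  set R' : ℝ := ‖p‖ + ρ with hR'
  have hR'0 : 0 ≤ R' := by positivity
  have hvR : tsupport (v : EuclideanSpace ℝ (Fin 4) → ℝ) ⊆ closedBall 0 R' := by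
    refine hball.trans (closedBall_subset_closedBall' ?_)
    rw [dist_zero_right]; linarith
  have hθR := Summit.QuantumFields.YangMills.Cruxes.NT.Reference.tsupport_thetaTest_subset_closedBall_zero hvR
  obtain ⟨s₁, hs₁, h₁⟩ := exists_latticeSum_abs_le v hvR
  obtain ⟨s₂, hs₂, h₂⟩ := exists_latticeSum_abs_le (thetaTest 4 v) hθR
  set s₀ : ℝ := min (min s₁ s₂) 1 with hs₀
  have hs₀0 : 0 < s₀ := by positivity
  have hev : ∀ᶠ β in atTop, a β < s₀ / Λ := hlim.eventually (gt_mem_nhds (by positivity))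
  obtain ⟨β₂, hβ₂⟩ := Filter.eventually_atTop.mp hev
  set Λ' : ℝ := max Λ (‖p‖ + 1) with hΛ'
  have hΛ'1 : 1 ≤ Λ' := hΛ.trans (le_max_left _ _)
  obtain ⟨β₀v, Λ₀v, hkv⟩ := hker v Λ' hΛ'1
  obtain ⟨β₀θ, Λ₀θ, hkθ⟩ := hker (thetaTest 4 v) Λ' hΛ'1
  refine ⟨R / 4, by positivity, max (max β₀v β₀θ) β₂, max (max Λ₀v Λ₀θ) (2 * R' + 1), fun β hβ L hL l hl => ?_⟩
  have hβv : β₀v ≤ β := le_trans ((le_max_left _ _).trans (le_max_left _ _)) hβ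
  have hβθ : β₀θ ≤ β := le_trans ((le_max_right _ _).trans (le_max_left _ _)) hβ
  have hβ2 : β₂ ≤ β := le_trans (le_max_right _ _) hβ
  have hLv : Λ₀v ≤ a β * L := le_trans ((le_max_left _ _).trans (le_max_left _ _)) hL
  have hLθ : Λ₀θ ≤ a β * L := le_trans ((le_max_right _ _).trans (le_max_left _ _)) hL
  have hL2R : 2 * R' + 1 ≤ a β * L := le_trans (le_max_right _ _) hL
  have haβ : 0 < a β := hpos β
  -- the spacing `s = l · aβ`
  set s : ℝ := l * a β with hsdef
  have hl1 : 1 ≤ l := hl.1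
  have hs : 0 < s := mul_pos (by linarith) haβ
  have hsaβ : a β ≤ s := by
    have := mul_le_mul_of_nonneg_right hl1 haβ.le
    rw [hsdef]; linarith
  have hsΛ : s ≤ Λ * a β := by rw [hsdef]; exact mul_le_mul_of_nonneg_right hl.2 haβ.le
  have hss₀ : s ≤ s₀ := by
    have h1 : a β < s₀ / Λ := hβ₂ β hβ2
    have h2 : Λ * a β ≤ Λ * (s₀ / Λ) := mul_le_mul_of_nonneg_left h1.le hΛ0.le
    have h3 : Λ * (s₀ / Λ) = s₀ := by field_simp
    linarith
  have hs1 : s ≤ 1 := le_trans hss₀ (min_le_right _ _)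
  have hss₁ : s ≤ s₁ := le_trans hss₀ (le_trans (min_le_left _ _) (min_le_left _ _))
  have hss₂ : s ≤ s₂ := le_trans hss₀ (le_trans (min_le_left _ _) (min_le_right _ _))
  have hsL : 2 * R' ≤ s * L := by
    have : a β * L ≤ s * L := mul_le_mul_of_nonneg_right hsaβ (Nat.cast_nonneg L)
    linarith
  have hRL : R' ≤ s * L := by linarith
  have hl_mem : l ∈ Set.Icc 1 Λ' := ⟨hl.1, hl.2.trans (le_max_left _ _)⟩
  -- Riemann sums (units `s` and units `aβ`)
  have hSv : s ^ 4 * ∑ z ∈ box 4 L, |v (s • siteToE z)| ≤ 2 := by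
    have := h₁ s hs hss₁ L hRL; linarith
  have hSθ : s ^ 4 * ∑ y ∈ box 4 L, |(thetaTest 4 v) (s • siteToE y)| ≤ 2 := by
    have := h₂ s hs hss₂ L hRL
    rw [Summit.QuantumFields.YangMills.Cruxes.NT.CeilingPrice.integral_abs_thetaTest] at this
    linarith
  have hSv0 : 0 ≤ ∑ z ∈ box 4 L, |v (s • siteToE z)| := Finset.sum_nonneg fun _ _ => abs_nonneg _
  have hSθ0 : 0 ≤ ∑ y ∈ box 4 L, |(thetaTest 4 v) (s • siteToE y)| := Finset.sum_nonneg fun _ _ => abs_nonneg _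
  have ha4s4 : (a β) ^ 4 ≤ s ^ 4 := pow_le_pow_left₀ haβ.le hsaβ 4
  have hSv' : (a β) ^ 4 * ∑ z ∈ box 4 L, |v (s • siteToE z)| ≤ 2 :=
    (mul_le_mul_of_nonneg_right ha4s4 hSv0).trans hSv
  have hSθ' : (a β) ^ 4 * ∑ y ∈ box 4 L, |(thetaTest 4 v) (s • siteToE y)| ≤ 2 :=
    (mul_le_mul_of_nonneg_right ha4s4 hSθ0).trans hSθ
  -- the kernel at `(β, L, l)` for the two weights
  have hkvβ := hkv β hβv L hLv l hl_mem
  have hkθβ := hkθ β hβθ L hLθ l hl_mem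
  -- supports read on the lattice
  set K : Set (EuclideanSpace ℝ (Fin 4)) :=
    tsupport (v : EuclideanSpace ℝ (Fin 4) → ℝ) ∪ tsupport (thetaTest 4 v : EuclideanSpace ℝ (Fin 4) → ℝ) with hKdef
  have hθpre := Summit.QuantumFields.YangMills.Cruxes.UVSeamRec.Q3MirrorFloors.tsupport_thetaTest_subset_preimage v
  have hmem_v : ∀ z : Fin 4 → ℤ, v (s • siteToE z) ≠ 0 → z ∈ box 4 L := fun z hz =>
    Summit.QuantumFields.YangMills.Cruxes.NT.CeilingPrice.mem_box_of_apply_ne_zero hs hvR hRL hz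
  have hmem_θ : ∀ y : Fin 4 → ℤ, (thetaTest 4 v) (s • siteToE y) ≠ 0 → y ∈ box 4 L := fun y hy =>
    Summit.QuantumFields.YangMills.Cruxes.NT.CeilingPrice.mem_box_of_apply_ne_zero hs hθR hRL hy
  have hball_v : ∀ z : Fin 4 → ℤ, v (s • siteToE z) ≠ 0 → s • siteToE z ∈ closedBall p ρ := fun z hz =>
    hball (subset_tsupport _ (Function.mem_support.2 hz))
  have hball_θ : ∀ y : Fin 4 → ℤ, (thetaTest 4 v) (s • siteToE y) ≠ 0 →
      (timeReflection 4) (s • siteToE y) ∈ closedBall p ρ := fun y hy =>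
    hball (hθpre (subset_tsupport _ (Function.mem_support.2 hy)))
  -- unit-`a` distance of two lattice points whose scaled images are `2ρ`-close
  have hdist_s : ∀ x w : Fin 4 → ℤ, dist (s • siteToE x) (s • siteToE w) = s * ‖siteToE x - siteToE w‖ := by
    intro x w
    rw [dist_eq_norm, ← smul_sub, norm_smul, Real.norm_of_nonneg hs.le]
  have hnear_a : ∀ x w : Fin 4 → ℤ, ∀ t : ℝ, dist (s • siteToE x) (s • siteToE w) ≤ t →
      a β * ‖siteToE (x - w)‖ ≤ t := by
    intro x w t h
    rw [hdist_s] at h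
    rw [siteToE_sub]
    exact (mul_le_mul_of_nonneg_right hsaβ (norm_nonneg _)).trans h
  have hnearT : ∀ x w : Fin 4 → ℤ, dist (s • siteToE x) (s • siteToE w) < R → a β * torusDist L x w < R := by
    intro x w hw
    have h1 : torusDist L x w ≤ ‖siteToE x - siteToE w‖ := torusDist_le_norm_sub L x w
    rw [hdist_s] at hw
    have h3 : a β * torusDist L x w ≤ s * ‖siteToE x - siteToE w‖ :=
      mul_le_mul hsaβ h1 (torusDist_nonneg L x w) hs.le
    linarith
  -- centre bound in units `a`
  have hcentre : ∀ w : Fin 4 → ℤ, ‖s • siteToE w‖ ≤ R' → ‖(a β) • siteToE w‖ ≤ Λ' := by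
    intro w hw
    have h1 : ‖(a β) • siteToE w‖ ≤ ‖s • siteToE w‖ := by
      rw [norm_smul, norm_smul, Real.norm_of_nonneg haβ.le, Real.norm_of_nonneg hs.le]
      exact mul_le_mul_of_nonneg_right hsaβ (norm_nonneg _)
    have h2 : R' ≤ ‖p‖ + 1 := by rw [hR']; linarith
    exact (h1.trans hw).trans (h2.trans (le_max_right _ _))
  -- separation of a charged pair `(y, z)` (θ-side `y`, v-side `z`) in units `a`, both orders
  have hsep : ∀ y z : Fin 4 → ℤ, (thetaTest 4 v) (s • siteToE y) ≠ 0 → v (s • siteToE z) ≠ 0 →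
      p 0 / Λ ≤ a β * torusDist L y z ∧ p 0 / Λ ≤ a β * torusDist L z y := by
    intro y z hθy hvz
    obtain ⟨hy1, hy2, hz1, hz2, hyR, hzR⟩ := pair_coords (s := s) hball hθy hvz
    have hlow : 2 * (p 0 / 2) ≤ s * ((z 0 : ℝ) - y 0) := by
      have : s * ((z 0 : ℝ) - y 0) = s * z 0 + -(s * y 0) := by ring
      rw [this]; linarith
    have hup : s * ((z 0 : ℝ) - y 0) ≤ 2 * R' := by
      have : s * ((z 0 : ℝ) - y 0) = s * z 0 + -(s * y 0) := by ring
      rw [this, hR']; linarith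
    obtain ⟨hd1, -⟩ := pair_torusDist hs (by positivity : (0 : ℝ) < p 0 / 2) hlow hup hyR hzR hsL
    have hdnn : 0 ≤ torusDist L y z := torusDist_nonneg L y z
    have hsep1 : p 0 / Λ ≤ a β * torusDist L y z := by
      rw [div_le_iff₀ hΛ0]
      have : torusDist L y z * s ≤ torusDist L y z * (Λ * a β) := mul_le_mul_of_nonneg_left hsΛ hdnn
      linarith
    exact ⟨hsep1, by rw [torusDist_comm L z y]; exact hsep1⟩
  ----------------------------------------------------------------------------------------------
  -- (3) the two smeared kernel bounds, per far index
  ----------------------------------------------------------------------------------------------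
  -- v-side: for any lattice support point `z₁` of `v(s·)` and any charged far `y`
  have hA : ∀ z₁ : Fin 4 → ℤ, v (s • siteToE z₁) ≠ 0 → ∀ y : Fin 4 → ℤ, (thetaTest 4 v) (s • siteToE y) ≠ 0 →
      (∑ x ∈ box 4 L, (if a β * torusDist L x z₁ < R then
        |∑ z ∈ box 4 L, v (s • siteToE z) * torusK3 G r β L x y z| else 0)) ≤ (η / 8) * (a β) ^ 4 := by
    intro z₁ hz₁ y hy
    obtain ⟨-, -, -, -, -, hz₁R⟩ := pair_coords (s := s) hball hy hz₁
    refine hkvβ y (hmem_θ y hy) z₁ (hmem_v z₁ hz₁) (hcentre z₁ hz₁R) (hsep y z₁ hy hz₁).1 (fun z hz => ⟨hmem_v z hz, ?_⟩) hSv'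
    -- support of `v(s·)` within unit-`a` distance `R` of `z₁`
    have h1 : dist (s • siteToE z) (s • siteToE z₁) ≤ ρ + ρ := by
      calc dist (s • siteToE z) (s • siteToE z₁) ≤ dist (s • siteToE z) p + dist p (s • siteToE z₁) := dist_triangle _ _ _
        _ ≤ ρ + ρ := add_le_add (mem_closedBall.1 (hball_v z hz))
            (by rw [dist_comm]; exact mem_closedBall.1 (hball_v z₁ hz₁))
    have h2 := hnear_a z z₁ _ h1
    linarith
  -- θ-side: for any lattice support point `y₁` of `θv(s·)` and any charged far `z`
  have hB : ∀ y₁ : Fin 4 → ℤ, (thetaTest 4 v) (s • siteToE y₁) ≠ 0 → ∀ z : Fin 4 → ℤ, v (s • siteToE z) ≠ 0 →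
      (∑ x ∈ box 4 L, (if a β * torusDist L x y₁ < R then
        |∑ y ∈ box 4 L, (thetaTest 4 v) (s • siteToE y) * torusK3 G r β L x z y| else 0)) ≤ (η / 8) * (a β) ^ 4 := by
    intro y₁ hy₁ z hz
    obtain ⟨-, -, -, -, hy₁R, -⟩ := pair_coords (s := s) hball hy₁ hz
    refine hkθβ z (hmem_v z hz) y₁ (hmem_θ y₁ hy₁) (hcentre y₁ hy₁R) (hsep y₁ z hy₁ hz).2 (fun y hy => ⟨hmem_θ y hy, ?_⟩) hSθ'
    have h1 : dist (s • siteToE y) (s • siteToE y₁) ≤ ρ + ρ := by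
      rw [← (timeReflection 4).isometry.dist_eq (s • siteToE y) (s • siteToE y₁)]
      calc dist ((timeReflection 4) (s • siteToE y)) ((timeReflection 4) (s • siteToE y₁))
          ≤ dist ((timeReflection 4) (s • siteToE y)) p + dist p ((timeReflection 4) (s • siteToE y₁)) := dist_triangle _ _ _
        _ ≤ ρ + ρ := add_le_add (mem_closedBall.1 (hball_θ y hy))
            (by rw [dist_comm]; exact mem_closedBall.1 (hball_θ y₁ hy₁))
    have h2 := hnear_a y y₁ _ h1
    linarith
  ----------------------------------------------------------------------------------------------
  -- (4) degenerate cases: a weight with empty lattice support makes the profile vanish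
  ----------------------------------------------------------------------------------------------
  set M : (Fin 4 → ℤ) → ℝ := fun x =>
    ∑ y ∈ box 4 L, ∑ z ∈ box 4 L, (thetaTest 4 v) (s • siteToE y) * v (s • siteToE z) * torusK3 G r β L x y z with hMdef
  have hgoal_of_zero : (∀ x, M x = 0) →
      (∑ x ∈ box 4 L, (if infDist (s • siteToE x) K < R / 4 then |M x| else 0)) ≤
        η * (1 + |deriv (fun c : ℝ => Q2 G r c L s (thetaTest 4 v) v) β|) := by
    intro h0
    have : (∑ x ∈ box 4 L, (if infDist (s • siteToE x) K < R / 4 then |M x| else 0)) = 0 := by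
      refine Finset.sum_eq_zero fun x _ => ?_
      rw [h0 x, abs_zero]; split_ifs <;> rfl
    rw [this]; positivity
  by_cases hv0 : ∀ z ∈ box 4 L, v (s • siteToE z) = 0
  · refine hgoal_of_zero fun x => Finset.sum_eq_zero fun y _ => Finset.sum_eq_zero fun z hz => ?_
    rw [hv0 z hz, mul_zero, zero_mul]
  by_cases hθ0 : ∀ y ∈ box 4 L, (thetaTest 4 v) (s • siteToE y) = 0
  · refine hgoal_of_zero fun x => Finset.sum_eq_zero fun y hy => Finset.sum_eq_zero fun z _ => ?_
    rw [hθ0 y hy, zero_mul, zero_mul]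
  push Not at hv0 hθ0
  obtain ⟨z₁, -, hz₁⟩ := hv0
  obtain ⟨y₁, -, hy₁⟩ := hθ0
  have hKne : K.Nonempty := ⟨s • siteToE z₁, Set.mem_union_left _ (subset_tsupport _ (Function.mem_support.2 hz₁))⟩
  ----------------------------------------------------------------------------------------------
  -- (5) pointwise domination of the collar term by the two smeared kernel terms
  ----------------------------------------------------------------------------------------------
  obtain ⟨A, hAdef⟩ : ∃ A : (Fin 4 → ℤ) → ℝ, ∀ x, A x = ∑ y ∈ box 4 L, |(thetaTest 4 v) (s • siteToE y)| *
      (if a β * torusDist L x z₁ < R then |∑ z ∈ box 4 L, v (s • siteToE z) * torusK3 G r β L x y z| else 0) :=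
    ⟨fun x => _, fun x => rfl⟩
  obtain ⟨B, hBdef⟩ : ∃ B : (Fin 4 → ℤ) → ℝ, ∀ x, B x = ∑ z ∈ box 4 L, |v (s • siteToE z)| *
      (if a β * torusDist L x y₁ < R then |∑ y ∈ box 4 L, (thetaTest 4 v) (s • siteToE y) * torusK3 G r β L x z y| else 0) :=
    ⟨fun x => _, fun x => rfl⟩
  have hA0 : ∀ x, 0 ≤ A x := by
    intro x
    rw [hAdef x]
    refine Finset.sum_nonneg fun y _ => mul_nonneg (abs_nonneg _) ?_
    split_ifs
    · exact abs_nonneg _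
    · exact le_rfl
  have hB0 : ∀ x, 0 ≤ B x := by
    intro x
    rw [hBdef x]
    refine Finset.sum_nonneg fun z _ => mul_nonneg (abs_nonneg _) ?_
    split_ifs
    · exact abs_nonneg _
    · exact le_rfl
  -- the two rearrangements of `M x`
  have hM_y : ∀ x, M x = ∑ y ∈ box 4 L, (thetaTest 4 v) (s • siteToE y) *
      ∑ z ∈ box 4 L, v (s • siteToE z) * torusK3 G r β L x y z := by
    intro x
    simp only [hMdef, Finset.mul_sum]
    refine Finset.sum_congr rfl fun y _ => Finset.sum_congr rfl fun z _ => by ring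
  have hM_z : ∀ x, M x = ∑ z ∈ box 4 L, v (s • siteToE z) *
      ∑ y ∈ box 4 L, (thetaTest 4 v) (s • siteToE y) * torusK3 G r β L x z y := by
    intro x
    simp only [hMdef]
    rw [Finset.sum_comm]
    simp only [Finset.mul_sum]
    refine Finset.sum_congr rfl fun z _ => Finset.sum_congr rfl fun y _ => ?_
    rw [torusK3_swap G r β L x z y]
    ring
  have hpt : ∀ x ∈ box 4 L, (if infDist (s • siteToE x) K < R / 4 then |M x| else 0) ≤ A x + B x := by
    intro x _
    by_cases hcol : infDist (s • siteToE x) K < R / 4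
    swap
    · rw [if_neg hcol]; exact add_nonneg (hA0 x) (hB0 x)
    rw [if_pos hcol]
    obtain ⟨k, hkK, hk⟩ := (infDist_lt_iff hKne).1 hcol
    rcases (Set.mem_union _ _ _).1 hkK with hkv | hkθ'
    · -- `k` on the source side: `x` is within unit-`a` torus distance `R` of `z₁`
      have hkball : k ∈ closedBall p ρ := hball hkv
      have hxz : dist (s • siteToE x) (s • siteToE z₁) < R := by
        calc dist (s • siteToE x) (s • siteToE z₁)
            ≤ dist (s • siteToE x) k + dist k (s • siteToE z₁) := dist_triangle _ _ _
          _ ≤ dist (s • siteToE x) k + (dist k p + dist p (s • siteToE z₁)) := by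
              linarith [dist_triangle k p (s • siteToE z₁)]
          _ < R / 4 + (ρ + ρ) := by
              have h1 : dist k p ≤ ρ := mem_closedBall.1 hkball
              have h2 : dist p (s • siteToE z₁) ≤ ρ := by rw [dist_comm]; exact mem_closedBall.1 (hball_v z₁ hz₁)
              linarith
          _ ≤ R := by linarith
      have hin : a β * torusDist L x z₁ < R := hnearT x z₁ hxz
      have hle : |M x| ≤ A x := by
        rw [hAdef, hM_y x]
        refine (Finset.abs_sum_le_sum_abs _ _).trans (Finset.sum_le_sum fun y _ => ?_)
        rw [abs_mul, if_pos hin]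
      linarith [hB0 x]
    · -- `k` on the reflected side: `x` is within unit-`a` torus distance `R` of `y₁`
      have hkball : (timeReflection 4) k ∈ closedBall p ρ := hball (hθpre hkθ')
      have hky : dist k (s • siteToE y₁) ≤ ρ + ρ := by
        rw [← (timeReflection 4).isometry.dist_eq k (s • siteToE y₁)]
        calc dist ((timeReflection 4) k) ((timeReflection 4) (s • siteToE y₁))
            ≤ dist ((timeReflection 4) k) p + dist p ((timeReflection 4) (s • siteToE y₁)) := dist_triangle _ _ _
          _ ≤ ρ + ρ := by
              have h1 : dist ((timeReflection 4) k) p ≤ ρ := mem_closedBall.1 hkball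
              have h2 : dist p ((timeReflection 4) (s • siteToE y₁)) ≤ ρ := by
                rw [dist_comm]; exact mem_closedBall.1 (hball_θ y₁ hy₁)
              linarith
      have hxy : dist (s • siteToE x) (s • siteToE y₁) < R := by
        calc dist (s • siteToE x) (s • siteToE y₁)
            ≤ dist (s • siteToE x) k + dist k (s • siteToE y₁) := dist_triangle _ _ _
          _ < R / 4 + (ρ + ρ) := by linarith
          _ ≤ R := by linarith
      have hin : a β * torusDist L x y₁ < R := hnearT x y₁ hxy
      have hle : |M x| ≤ B x := by
        rw [hBdef, hM_z x]
        refine (Finset.abs_sum_le_sum_abs _ _).trans (Finset.sum_le_sum fun z _ => ?_)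
        rw [abs_mul, if_pos hin]
      linarith [hA0 x]
  ----------------------------------------------------------------------------------------------
  -- (6) summation: swap the sums and use the kernel bounds per far index and the Riemann bounds
  ----------------------------------------------------------------------------------------------
  have hsumA : ∑ x ∈ box 4 L, A x ≤ (∑ y ∈ box 4 L, |(thetaTest 4 v) (s • siteToE y)|) * ((η / 8) * (a β) ^ 4) := by
    have e : ∑ x ∈ box 4 L, A x = ∑ y ∈ box 4 L, |(thetaTest 4 v) (s • siteToE y)| *
        ∑ x ∈ box 4 L, (if a β * torusDist L x z₁ < R then
          |∑ z ∈ box 4 L, v (s • siteToE z) * torusK3 G r β L x y z| else 0) := by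
      rw [Finset.sum_congr rfl fun x _ => hAdef x, Finset.sum_comm]
      refine Finset.sum_congr rfl fun y _ => ?_
      rw [Finset.mul_sum]
    rw [e, Finset.sum_mul]
    refine Finset.sum_le_sum fun y _ => ?_
    by_cases hθy : (thetaTest 4 v) (s • siteToE y) = 0
    · rw [hθy]; simp
    exact mul_le_mul_of_nonneg_left (hA z₁ hz₁ y hθy) (abs_nonneg _)
  have hsumB : ∑ x ∈ box 4 L, B x ≤ (∑ z ∈ box 4 L, |v (s • siteToE z)|) * ((η / 8) * (a β) ^ 4) := by
    have e : ∑ x ∈ box 4 L, B x = ∑ z ∈ box 4 L, |v (s • siteToE z)| *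
        ∑ x ∈ box 4 L, (if a β * torusDist L x y₁ < R then
          |∑ y ∈ box 4 L, (thetaTest 4 v) (s • siteToE y) * torusK3 G r β L x z y| else 0) := by
      rw [Finset.sum_congr rfl fun x _ => hBdef x, Finset.sum_comm]
      refine Finset.sum_congr rfl fun z _ => ?_
      rw [Finset.mul_sum]
    rw [e, Finset.sum_mul]
    refine Finset.sum_le_sum fun z _ => ?_
    by_cases hvz : v (s • siteToE z) = 0
    · rw [hvz]; simp
    exact mul_le_mul_of_nonneg_left (hB y₁ hy₁ z hvz) (abs_nonneg _)
  -- Riemann: `Σ|θv| · (η/8)(aβ)⁴ ≤ η/4`, `Σ|v| · (η/8)(aβ)⁴ ≤ η/4`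
  have hs4 : 0 < s ^ 4 := by positivity
  have hRθ : (∑ y ∈ box 4 L, |(thetaTest 4 v) (s • siteToE y)|) * ((η / 8) * (a β) ^ 4) ≤ η / 4 := by
    have h1 : (∑ y ∈ box 4 L, |(thetaTest 4 v) (s • siteToE y)|) * (a β) ^ 4 ≤ 2 := by
      rw [mul_comm]; exact hSθ'
    have e : (∑ y ∈ box 4 L, |(thetaTest 4 v) (s • siteToE y)|) * ((η / 8) * (a β) ^ 4) =
        (η / 8) * ((∑ y ∈ box 4 L, |(thetaTest 4 v) (s • siteToE y)|) * (a β) ^ 4) := by ring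
    rw [e]
    calc (η / 8) * ((∑ y ∈ box 4 L, |(thetaTest 4 v) (s • siteToE y)|) * (a β) ^ 4) ≤ (η / 8) * 2 :=
          mul_le_mul_of_nonneg_left h1 (by positivity)
      _ = η / 4 := by ring
  have hRv : (∑ z ∈ box 4 L, |v (s • siteToE z)|) * ((η / 8) * (a β) ^ 4) ≤ η / 4 := by
    have h1 : (∑ z ∈ box 4 L, |v (s • siteToE z)|) * (a β) ^ 4 ≤ 2 := by
      rw [mul_comm]; exact hSv'
    have e : (∑ z ∈ box 4 L, |v (s • siteToE z)|) * ((η / 8) * (a β) ^ 4) =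
        (η / 8) * ((∑ z ∈ box 4 L, |v (s • siteToE z)|) * (a β) ^ 4) := by ring
    rw [e]
    calc (η / 8) * ((∑ z ∈ box 4 L, |v (s • siteToE z)|) * (a β) ^ 4) ≤ (η / 8) * 2 :=
          mul_le_mul_of_nonneg_left h1 (by positivity)
      _ = η / 4 := by ring
  have hD0 : 0 ≤ |deriv (fun c : ℝ => Q2 G r c L s (thetaTest 4 v) v) β| := abs_nonneg _
  calc (∑ x ∈ box 4 L, (if infDist (s • siteToE x) K < R / 4 then |M x| else 0))
      ≤ ∑ x ∈ box 4 L, (A x + B x) := Finset.sum_le_sum hpt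
    _ = (∑ x ∈ box 4 L, A x) + ∑ x ∈ box 4 L, B x := Finset.sum_add_distrib
    _ ≤ η / 4 + η / 4 := add_le_add (hsumA.trans hRθ) (hsumB.trans hRv)
    _ ≤ η * (1 + |deriv (fun c : ℝ => Q2 G r c L s (thetaTest 4 v) v) β|) := by nlinarith [hη, hD0]

end Summit.QuantumFields.YangMills.Cruxes.ResponseLocalisation.Smeared

end
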